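import Summits.CriticalPhenomena.PercolationContinuityZ3.Theses.PercNonProliferation
import Summits.CriticalPhenomena.PercolationContinuityZ3.Theorems.FreeBoxPowerSaving.Negative.FreeBoxPowerSavingOneArm
import Summits.CriticalPhenomena.PercolationContinuityZ3.Theorems.SubpolynomialBlocking.Negative.OffCritical
import Summits.CriticalPhenomena.PercolationContinuityZ3.Theorems.PercNonProliferationSpanningBKCap
import Summits.CriticalPhenomena.PercolationContinuityZ3.Theorems.PercNonProliferationPolynomialAssembly
import Summits.CriticalPhenomena.PercolationContinuityZ3.Theorems.PercNonProliferationNonProliferationPowerCap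
import Summits.CriticalPhenomena.PercolationContinuityZ3.Theorems.PercNonSelfAveragingStrictFKGLadder
import Summits.CriticalPhenomena.PercolationContinuityZ3.Theorems.PercNonProliferationFreeBoxPowerSavingArmCauchySchwarz
import Summits.CriticalPhenomena.PercolationContinuityZ3.Theorems.PercNonProliferationFreeBoxPowerSavingPairGivesOneArm
import Summits.CriticalPhenomena.PercolationContinuityZ3.Theorems.PercNonProliferationFreeBoxPowerSavingUnconditionalArmFromCrux
import Summits.CriticalPhenomena.PercolationContinuityZ3.Theorems.PercNonProliferationFreeBoxPowerSavingCesaroBlockingGivesOneArm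

/-!
# Line skeleton — crux stmt-CriticalPhenomena-4447 `PercNonProliferation.FreeBoxPowerSaving`,
# line `Sketch_r2_ideator4` (card `onearm-currency-arm-cauchy-schwarz`, round-2 ideator 4)

Lead `prover-line-stmt-CriticalPhenomena-4447-a2-0` (re-seated after the five round-1 lines died, 2026-08-16).
The ideator's `Sketch_r2_ideator4.lean` is not an eligible skeleton (Props only, no `FreeBoxPowerSaving_of`, no
`stub_*`), so this file OWNS and reshapes it over the tree's vocabulary (`oneArmProb`,
`FreeBoxPowerSavingNegative.fa2 / pairSum`, the route's representative events).

The crux: `∃ a C, 0 < a ∧ ∀ n ≥ 1, FA₂(p_c, n) ≤ C n^{-a}`, `FA₂(p, n) = |B(n)|⁻² Σ_{x,y∈B(n)} P_p(x ↔ y in B(n))`.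

## The line
Notation: `π_p(m) = oneArmProb 3 p m = P_p(0 ↔ ∂ⁱⁿB(m) in B(m))`, `E_p[N_n] = meanSpanning p n` (layer-cake sum of
the route's representative events = mean number of clusters of the open graph induced on `B(2n)` meeting `B(n)`
and `∂ⁱⁿB(2n)`), `A_p(n) = armMass p n = Σ_{x∈B(n)} P_p(x ↔ ∂ⁱⁿB(2n) in B(2n))`, `E_p[S_n] = pairsIn p n`,
`u_m(p) = blockAt p m = P_p(B(m) ↮ ∂ⁱⁿB(2m) in B(2m))`.

* DICTIONARY (crux ⟹ one-arm, modulo r4).  Arm-mass Cauchy–Schwarz `A_p(n)² ≤ E_p[N_n]·E_p[S_n]`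
  (`stub_armCauchySchwarz`, every `p,n`), arm floor `|B(n)|·π_p(3n) ≤ A_p(n)` (`armFloor`, PROVED here from the
  tree's `oneArmProb_three_mul_le_real_toBdry`), `E_p[S_n] ≤ |B(2n)|² FA₂ᵖ(2n)`, `|B(2n)| ≤ 8|B(n)|` give the
  arm–spanning–pair inequality ASP `π_p(3n)² ≤ 64·E_p[N_n]·FA₂ᵖ(2n)` (`armSpanningPair_of`, PROVED here, glue);
  with `SpanningBKCap` (landed) `E[N_n] ≤ 1/u_n` and r4 `u_n ≥ n^{-s}` eventually: r4 ∧ crux(a) ⟹ one-arm decay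
  with every exponent `< a/2` (`stub_pairGivesOneArm`); unconditionally, with the landed PowerCap
  `E_{p_c}[N_n] ≤ C n^{2-β}`: crux(a), `a > 2-β` ⟹ one-arm decay `(a-2+β)/2` (`stub_unconditionalArmFromCrux`).
* ENGINE SIDE (one-arm ⟹ crux, landed p75695 `of_oneArm_decay`, sharp `a = 2s`), fed by its weakest multi-scale
  input: Cesàro blocking `liminf_K K⁻¹ Σ_{j<K} u_{2^j} > 0` ⟹ one-arm power decay (`stub_cesaroBlockingGivesOneArm`,
  BK/Reimer over the nested dyadic annuli, every `p`) ⟹ crux.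
* TRANSFER STUB (lead-held, OPEN, declared SUMMIT-strength by the card and by this file: it implies θ(p_c)=0 via
  the two previous bullets): `stub_cesaroBlocking` at `p_c(ℤ³)`.

## Registered stubs (statements spelled out def-free in `Sig`; v2: four LANDED and wired in by name, ONE `sorry` left)
`stub_armCauchySchwarz` (LANDED p125191), `stub_pairGivesOneArm` (LANDED p125354), `stub_unconditionalArmFromCrux`
(LANDED p125680), `stub_cesaroBlockingGivesOneArm` (LANDED p126229, independence route: pure scale-`j` crossings are
determined by the disjoint pair classes `Λ_{2^{j+1}}.sym2 ∖ Λ_{2^j}.sym2`), `stub_cesaroBlocking` (OPEN, transfer, the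
only `sorry`).  All four landed files live in namespace `Summit.CriticalPhenomena.PercolationContinuityZ3.FreeBoxPowerSavingLine`
(`Theorems/PercNonProliferationFreeBoxPowerSaving{ArmCauchySchwarz,PairGivesOneArm,UnconditionalArmFromCrux,CesaroBlockingGivesOneArm}.lean`).

## Composition (sorry-free outside the stubs)
`FreeBoxPowerSaving_of : Sig.stub_cesaroBlocking → FreeBoxPowerSaving` (via `stub_cesaroBlockingGivesOneArm` and the
landed `of_oneArm_decay`), and the dictionary `crux_iff_oneArmPowerDecay_of_subpolynomialBlocking`.
Disproof v12 honoured: `false_at_one` — at `p = 1`, `π ≡ 1`, `E[N] = 1`, `FA₂ ≡ 1`, ASP reads `1 ≤ 64`, and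
`u_m(1) = 0` so Cesàro blocking fails: criticality enters ONLY through `stub_cesaroBlocking`; `false_without_guard` —
every conclusion keeps `1 ≤ n` / `1 ≤ m`; `exponent_le_two` ⟺ `oneArm_exponent_le_one` under `a = 2s`.
-/

noncomputable section

open MeasureTheory Filter
open Literature.Probability.Percolation Literature.Probability.LatticeModels
open Summit.CriticalPhenomena.PercolationContinuityZ3.Theses.PercNonProliferation
open Summit.CriticalPhenomena.PercolationContinuityZ3.FreeBoxPowerSavingNegative
  (pairSum fa2 freeBoxPowerSaving_iff_fa2 pairSum_nonneg card_box_pos card_box_real fa2_nonneg of_oneArm_decay)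
open scoped Topology BigOperators

namespace Summit.CriticalPhenomena.PercolationContinuityZ3.Cruxes.FreeBoxPowerSaving.OneArmCurrencyLine

/-! ## §1 Local vocabulary -/

/-- `E_p[N_n]`: the mean number of clusters of the open graph induced on `B(2n)` meeting both `B(n)` and
`∂ⁱⁿB(2n)`, as the finite layer-cake sum over representatives (verbatim the first factor of the route item
`MeanCauchySchwarz`). -/
def meanSpanning (p : unitInterval) (n : ℕ) : ℝ :=
  ∑ k ∈ Finset.range (box 3 n).card, (bondPercolation (zdGraph 3) p).real
    {ω | ∃ x : Fin (k + 1) → Site 3, (∀ i, x i ∈ box 3 n) ∧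
      (∀ i, ∃ y ∈ innerBoundary (zdGraph 3) (box 3 (2 * n)),
        ω ∈ openConnIn (↑(box 3 (2 * n)) : Set (Site 3)) (x i) y) ∧
      ∀ i j, i ≠ j → ω ∉ openConnIn (↑(box 3 (2 * n)) : Set (Site 3)) (x i) (x j)}

/-- The in-box ARM MASS `A_p(n) := Σ_{x ∈ B(n)} P_p(x ↔ ∂ⁱⁿB(2n) inside B(2n))`. -/
def armMass (p : unitInterval) (n : ℕ) : ℝ :=
  ∑ x ∈ box 3 n, (bondPercolation (zdGraph 3) p).real
    {ω | ∃ y ∈ innerBoundary (zdGraph 3) (box 3 (2 * n)),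
      ω ∈ openConnIn (↑(box 3 (2 * n)) : Set (Site 3)) x y}

/-- `E_p[S_n]`: expected number of ordered pairs of `B(n)` joined inside `B(2n)`. -/
def pairsIn (p : unitInterval) (n : ℕ) : ℝ :=
  ∑ x ∈ box 3 n, ∑ y ∈ box 3 n,
    (bondPercolation (zdGraph 3) p).real (openConnIn (↑(box 3 (2 * n)) : Set (Site 3)) x y)

/-- The annulus-blocking probability `u_m(p) = P_p(B(m) ↮ ∂ⁱⁿB(2m) inside B(2m))` (the route's r4 event). -/
def blockAt (p : unitInterval) (m : ℕ) : ℝ :=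
  (bondPercolation (zdGraph 3) p).real
    {ω | ¬ ∃ x ∈ box 3 m, ∃ y ∈ innerBoundary (zdGraph 3) (box 3 (2 * m)),
      ω ∈ openConnIn (↑(box 3 (2 * m)) : Set (Site 3)) x y}

/-- Polynomial one-arm decay at parameter `p`: `∃ s > 0, C, ∀ m ≥ 1, π_p(m) ≤ C m^{-s}`. -/
def OneArmPowerDecayAt (p : unitInterval) : Prop :=
  ∃ s C : ℝ, 0 < s ∧ ∀ m : ℕ, 1 ≤ m → oneArmProb 3 p m ≤ C * (m : ℝ) ^ (-s)

/-- Cesàro blocking at parameter `p`: the dyadic annuli are blocked at a positive rate along the scale axis,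
`∃ c > 0, ∀ᶠ K, c·K ≤ Σ_{j<K} u_{2^j}(p)`. -/
def CesaroBlockingAt (p : unitInterval) : Prop :=
  ∃ c : ℝ, 0 < c ∧ ∀ᶠ K : ℕ in atTop, c * (K : ℝ) ≤ ∑ j ∈ Finset.range K, blockAt p (2 ^ j)

namespace Sig

/-- Registered text of `stub_armCauchySchwarz` (`A_p(n)² ≤ E_p[N_n] · E_p[S_n]`, every `p`, `n`). -/
def stub_armCauchySchwarz : Prop :=
  ∀ (p : unitInterval) (n : ℕ),
    (∑ x ∈ box 3 n, (bondPercolation (zdGraph 3) p).real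
        {ω | ∃ y ∈ innerBoundary (zdGraph 3) (box 3 (2 * n)),
          ω ∈ openConnIn (↑(box 3 (2 * n)) : Set (Site 3)) x y}) ^ 2 ≤
      (∑ k ∈ Finset.range (box 3 n).card, (bondPercolation (zdGraph 3) p).real
        {ω | ∃ x : Fin (k + 1) → Site 3, (∀ i, x i ∈ box 3 n) ∧
          (∀ i, ∃ y ∈ innerBoundary (zdGraph 3) (box 3 (2 * n)),
            ω ∈ openConnIn (↑(box 3 (2 * n)) : Set (Site 3)) (x i) y) ∧
          ∀ i j, i ≠ j → ω ∉ openConnIn (↑(box 3 (2 * n)) : Set (Site 3)) (x i) (x j)}) *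
      ∑ x ∈ box 3 n, ∑ y ∈ box 3 n,
        (bondPercolation (zdGraph 3) p).real (openConnIn (↑(box 3 (2 * n)) : Set (Site 3)) x y)

/-- Registered text of `stub_armSpanningPair` (the ASP inequality itself, every `p`, `n ≥ 1`; v3: registered so that
the Theorems-level dictionary file can land it by name). -/
def stub_armSpanningPair : Prop :=
  ∀ (p : unitInterval) (n : ℕ), 1 ≤ n →
    oneArmProb 3 p (3 * n) ^ 2 ≤
      64 * (∑ k ∈ Finset.range (box 3 n).card, (bondPercolation (zdGraph 3) p).real
        {ω | ∃ x : Fin (k + 1) → Site 3, (∀ i, x i ∈ box 3 n) ∧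
          (∀ i, ∃ y ∈ innerBoundary (zdGraph 3) (box 3 (2 * n)),
            ω ∈ openConnIn (↑(box 3 (2 * n)) : Set (Site 3)) (x i) y) ∧
          ∀ i j, i ≠ j → ω ∉ openConnIn (↑(box 3 (2 * n)) : Set (Site 3)) (x i) (x j)}) *
      ((∑ x ∈ box 3 (2 * n), ∑ y ∈ box 3 (2 * n),
          (bondPercolation (zdGraph 3) p).real (openConnIn (↑(box 3 (2 * n)) : Set (Site 3)) x y)) /
        ((box 3 (2 * n)).card : ℝ) ^ 2)

/-- Registered text of `stub_pairGivesOneArm`: ASP → r4 → crux → one-arm power decay at `p_c`. -/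
def stub_pairGivesOneArm : Prop :=
  (∀ (p : unitInterval) (n : ℕ), 1 ≤ n →
    oneArmProb 3 p (3 * n) ^ 2 ≤
      64 * (∑ k ∈ Finset.range (box 3 n).card, (bondPercolation (zdGraph 3) p).real
        {ω | ∃ x : Fin (k + 1) → Site 3, (∀ i, x i ∈ box 3 n) ∧
          (∀ i, ∃ y ∈ innerBoundary (zdGraph 3) (box 3 (2 * n)),
            ω ∈ openConnIn (↑(box 3 (2 * n)) : Set (Site 3)) (x i) y) ∧
          ∀ i j, i ≠ j → ω ∉ openConnIn (↑(box 3 (2 * n)) : Set (Site 3)) (x i) (x j)}) *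
      ((∑ x ∈ box 3 (2 * n), ∑ y ∈ box 3 (2 * n),
          (bondPercolation (zdGraph 3) p).real (openConnIn (↑(box 3 (2 * n)) : Set (Site 3)) x y)) /
        ((box 3 (2 * n)).card : ℝ) ^ 2)) →
  Summit.CriticalPhenomena.PercolationContinuityZ3.Theses.PercNonProliferation.SubpolynomialBlocking →
  Summit.CriticalPhenomena.PercolationContinuityZ3.Theses.PercNonProliferation.FreeBoxPowerSaving →
    ∃ s C : ℝ, 0 < s ∧ ∀ m : ℕ, 1 ≤ m → oneArmProb 3 (criticalProbI 3) m ≤ C * (m : ℝ) ^ (-s)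

/-- Registered text of `stub_unconditionalArmFromCrux`: ASP (at `p_c`) → for some `β > 0` (the landed PowerCap
exponent), a free-box power saving with exponent `a > 2 - β` gives one-arm decay with exponent `(a-2+β)/2`. -/
def stub_unconditionalArmFromCrux : Prop :=
  (∀ n : ℕ, 1 ≤ n →
    oneArmProb 3 (criticalProbI 3) (3 * n) ^ 2 ≤
      64 * (∑ k ∈ Finset.range (box 3 n).card, (bondPercolation (zdGraph 3) (criticalProbI 3)).real
        {ω | ∃ x : Fin (k + 1) → Site 3, (∀ i, x i ∈ box 3 n) ∧
          (∀ i, ∃ y ∈ innerBoundary (zdGraph 3) (box 3 (2 * n)),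
            ω ∈ openConnIn (↑(box 3 (2 * n)) : Set (Site 3)) (x i) y) ∧
          ∀ i j, i ≠ j → ω ∉ openConnIn (↑(box 3 (2 * n)) : Set (Site 3)) (x i) (x j)}) *
      ((∑ x ∈ box 3 (2 * n), ∑ y ∈ box 3 (2 * n),
          (bondPercolation (zdGraph 3) (criticalProbI 3)).real
            (openConnIn (↑(box 3 (2 * n)) : Set (Site 3)) x y)) /
        ((box 3 (2 * n)).card : ℝ) ^ 2)) →
    ∃ β : ℝ, 0 < β ∧ ∀ a C : ℝ, 2 - β < a →
      (∀ n : ℕ, 1 ≤ n →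
        (∑ x ∈ box 3 n, ∑ y ∈ box 3 n,
            (bondPercolation (zdGraph 3) (criticalProbI 3)).real
              (openConnIn (↑(box 3 n) : Set (Site 3)) x y)) /
          ((box 3 n).card : ℝ) ^ 2 ≤ C * (n : ℝ) ^ (-a)) →
      ∃ C' : ℝ, ∀ m : ℕ, 1 ≤ m →
        oneArmProb 3 (criticalProbI 3) m ≤ C' * (m : ℝ) ^ (-((a - 2 + β) / 2))

/-- Registered text of `stub_cesaroBlockingGivesOneArm`: Cesàro blocking at `p` ⟹ one-arm power decay at `p`
(every `p`; BK/Reimer over the nested dyadic annuli). -/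
def stub_cesaroBlockingGivesOneArm : Prop :=
  ∀ p : unitInterval,
    (∃ c : ℝ, 0 < c ∧ ∀ᶠ K : ℕ in atTop, c * (K : ℝ) ≤
      ∑ j ∈ Finset.range K, (bondPercolation (zdGraph 3) p).real
        {ω | ¬ ∃ x ∈ box 3 (2 ^ j), ∃ y ∈ innerBoundary (zdGraph 3) (box 3 (2 * 2 ^ j)),
          ω ∈ openConnIn (↑(box 3 (2 * 2 ^ j)) : Set (Site 3)) x y}) →
    ∃ s C : ℝ, 0 < s ∧ ∀ m : ℕ, 1 ≤ m → oneArmProb 3 p m ≤ C * (m : ℝ) ^ (-s)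

/-- Registered text of `stub_cesaroBlocking` (the transfer stub, at `p_c(ℤ³)`; OPEN, summit-strength). -/
def stub_cesaroBlocking : Prop :=
  ∃ c : ℝ, 0 < c ∧ ∀ᶠ K : ℕ in atTop, c * (K : ℝ) ≤
    ∑ j ∈ Finset.range K, (bondPercolation (zdGraph 3) (criticalProbI 3)).real
      {ω | ¬ ∃ x ∈ box 3 (2 ^ j), ∃ y ∈ innerBoundary (zdGraph 3) (box 3 (2 * 2 ^ j)),
        ω ∈ openConnIn (↑(box 3 (2 * 2 ^ j)) : Set (Site 3)) x y}

end Sig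

/-! ## §2 Bridges to the local vocabulary (`Iff.rfl`) -/

/-- `Sig.stub_armCauchySchwarz` in local words. [folklore] -/
theorem sig_armCauchySchwarz_iff :
    Sig.stub_armCauchySchwarz ↔ ∀ (p : unitInterval) (n : ℕ), armMass p n ^ 2 ≤ meanSpanning p n * pairsIn p n :=
  Iff.rfl

/-- `Sig.stub_pairGivesOneArm` in local words. [folklore] -/
theorem sig_pairGivesOneArm_iff :
    Sig.stub_pairGivesOneArm ↔
      ((∀ (p : unitInterval) (n : ℕ), 1 ≤ n → oneArmProb 3 p (3 * n) ^ 2 ≤ 64 * meanSpanning p n * fa2 p (2 * n)) →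
        SubpolynomialBlocking → FreeBoxPowerSaving → OneArmPowerDecayAt (criticalProbI 3)) :=
  Iff.rfl

/-- `Sig.stub_unconditionalArmFromCrux` in local words. [folklore] -/
theorem sig_unconditionalArmFromCrux_iff :
    Sig.stub_unconditionalArmFromCrux ↔
      ((∀ n : ℕ, 1 ≤ n → oneArmProb 3 (criticalProbI 3) (3 * n) ^ 2 ≤
          64 * meanSpanning (criticalProbI 3) n * fa2 (criticalProbI 3) (2 * n)) →
        ∃ β : ℝ, 0 < β ∧ ∀ a C : ℝ, 2 - β < a →
          (∀ n : ℕ, 1 ≤ n → fa2 (criticalProbI 3) n ≤ C * (n : ℝ) ^ (-a)) →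
          ∃ C' : ℝ, ∀ m : ℕ, 1 ≤ m →
            oneArmProb 3 (criticalProbI 3) m ≤ C' * (m : ℝ) ^ (-((a - 2 + β) / 2))) :=
  Iff.rfl

/-- `Sig.stub_cesaroBlockingGivesOneArm` in local words. [folklore] -/
theorem sig_cesaroBlockingGivesOneArm_iff :
    Sig.stub_cesaroBlockingGivesOneArm ↔ ∀ p : unitInterval, CesaroBlockingAt p → OneArmPowerDecayAt p :=
  Iff.rfl

/-- `Sig.stub_cesaroBlocking` in local words. [folklore] -/
theorem sig_cesaroBlocking_iff : Sig.stub_cesaroBlocking ↔ CesaroBlockingAt (criticalProbI 3) :=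
  Iff.rfl

/-! ## §3 Registered stubs (v2: four are the landed theorems, by name; one `sorry` = the transfer stub) -/

/-- **stub_armCauchySchwarz (arm-mass Cauchy–Schwarz; every `p`, `n`; provable now, M).**
`A_p(n)² ≤ E_p[N_n] · E_p[S_n]`.  Pointwise (every `ω`, no `ω ⊆ E(ℤ³)` needed): the points `x ∈ B(n)` joined inside
`B(2n)` to `∂ⁱⁿB(2n)` (the ARMED points, `V` of them) fall into classes of `x ~ y :⟺ x ↔ y in B(2n)`; representatives
of `k+1` classes witness the `k`-th representative event, so the number of classes is `≤ N := #{k : k-th event}`;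
Cauchy–Schwarz over the classes gives `V² ≤ N · S`, `S = Σ_{x∈B(n)} #{y ∈ B(n) : x ↔ y in B(2n)}` — verbatim
`MeanCauchySchwarz.card_sq_le_card_image_mul_sum` / `exists_transversal` with `P := armed points` (the clause
"each representative is joined to `∂ⁱⁿB(2n)`" now holds by definition of `P`).  Then integrate:
`(E V)² ≤ E[N]·E[S]` (`MeanCauchySchwarz.sq_integral_le_mul_integral`; the mean of `V` is `A_p(n)`, a sum of
DIFFERENT probabilities — adapt `sq_mul_card_le_of_ae` with `Σ_x μ(Pev x)` in place of `θ|B|`). [folklore] -/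
theorem stub_armCauchySchwarz :
    ∀ (p : unitInterval) (n : ℕ),
      (∑ x ∈ box 3 n, (bondPercolation (zdGraph 3) p).real
          {ω | ∃ y ∈ innerBoundary (zdGraph 3) (box 3 (2 * n)),
            ω ∈ openConnIn (↑(box 3 (2 * n)) : Set (Site 3)) x y}) ^ 2 ≤
        (∑ k ∈ Finset.range (box 3 n).card, (bondPercolation (zdGraph 3) p).real
          {ω | ∃ x : Fin (k + 1) → Site 3, (∀ i, x i ∈ box 3 n) ∧
            (∀ i, ∃ y ∈ innerBoundary (zdGraph 3) (box 3 (2 * n)),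
              ω ∈ openConnIn (↑(box 3 (2 * n)) : Set (Site 3)) (x i) y) ∧
            ∀ i j, i ≠ j → ω ∉ openConnIn (↑(box 3 (2 * n)) : Set (Site 3)) (x i) (x j)}) *
        ∑ x ∈ box 3 n, ∑ y ∈ box 3 n,
          (bondPercolation (zdGraph 3) p).real (openConnIn (↑(box 3 (2 * n)) : Set (Site 3)) x y) :=
  -- LANDED: p125191, Theorems/PercNonProliferationFreeBoxPowerSavingArmCauchySchwarz.lean
  Summit.CriticalPhenomena.PercolationContinuityZ3.FreeBoxPowerSavingLine.stub_armCauchySchwarz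

/-- **stub_pairGivesOneArm (ASP + r4 + crux ⟹ one-arm power decay at `p_c`; provable now, M).**
Given ASP, `SpanningBKCap` (landed `spanningBKCap_proof`, summed: `E[N_n] ≤ 1/u_n`,
`SubpolynomialBlocking.meanSpanning_le_one_div_blocking`), r4 at `s := a/2` (`u_n ≥ n^{-a/2}` eventually) and
the crux (`FA₂(2n) ≤ C (2n)^{-a}`): `π(3n)² ≤ 64 C 2^{-a} n^{a/2 - a}` eventually, so `π(3n) ≤ C₁ n^{-a/4}`
eventually; extend to all `m ≥ 1` by antitonicity of `m ↦ π(m)` (`DCT16.real_siteToBoundary_antitone`,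
`m ∈ [3n, 3n+3)`) and absorb the finitely many small `m` into the constant (`π ≤ 1`). [folklore] -/
theorem stub_pairGivesOneArm :
    (∀ (p : unitInterval) (n : ℕ), 1 ≤ n →
      oneArmProb 3 p (3 * n) ^ 2 ≤
        64 * (∑ k ∈ Finset.range (box 3 n).card, (bondPercolation (zdGraph 3) p).real
          {ω | ∃ x : Fin (k + 1) → Site 3, (∀ i, x i ∈ box 3 n) ∧
            (∀ i, ∃ y ∈ innerBoundary (zdGraph 3) (box 3 (2 * n)),
              ω ∈ openConnIn (↑(box 3 (2 * n)) : Set (Site 3)) (x i) y) ∧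
            ∀ i j, i ≠ j → ω ∉ openConnIn (↑(box 3 (2 * n)) : Set (Site 3)) (x i) (x j)}) *
        ((∑ x ∈ box 3 (2 * n), ∑ y ∈ box 3 (2 * n),
            (bondPercolation (zdGraph 3) p).real (openConnIn (↑(box 3 (2 * n)) : Set (Site 3)) x y)) /
          ((box 3 (2 * n)).card : ℝ) ^ 2)) →
    Summit.CriticalPhenomena.PercolationContinuityZ3.Theses.PercNonProliferation.SubpolynomialBlocking →
    Summit.CriticalPhenomena.PercolationContinuityZ3.Theses.PercNonProliferation.FreeBoxPowerSaving →
      ∃ s C : ℝ, 0 < s ∧ ∀ m : ℕ, 1 ≤ m → oneArmProb 3 (criticalProbI 3) m ≤ C * (m : ℝ) ^ (-s) :=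
  -- LANDED: p125354, Theorems/PercNonProliferationFreeBoxPowerSavingPairGivesOneArm.lean
  Summit.CriticalPhenomena.PercolationContinuityZ3.FreeBoxPowerSavingLine.stub_pairGivesOneArm

/-- **stub_unconditionalArmFromCrux (ASP + landed PowerCap ⟹ an unconditional arm rate from the crux; provable
now, M).**  With `NonProliferation.expected_numSpanning_le_rpow` (`E_{p_c}[N_n] ≤ C₀ n^{2-β}`, `β > 0`; its event
`repEvent 3 k n` is the representative event verbatim): `π(3n)² ≤ 64 C₀ n^{2-β} C 2^{-a} n^{-a}`, i.e.
`π(3n) ≤ C₁ n^{-(a-2+β)/2}` for `n ≥ 1` (non-vacuous iff `a > 2 - β`), then all `m ≥ 1` by antitonicity. [folklore] -/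
theorem stub_unconditionalArmFromCrux :
    (∀ n : ℕ, 1 ≤ n →
      oneArmProb 3 (criticalProbI 3) (3 * n) ^ 2 ≤
        64 * (∑ k ∈ Finset.range (box 3 n).card, (bondPercolation (zdGraph 3) (criticalProbI 3)).real
          {ω | ∃ x : Fin (k + 1) → Site 3, (∀ i, x i ∈ box 3 n) ∧
            (∀ i, ∃ y ∈ innerBoundary (zdGraph 3) (box 3 (2 * n)),
              ω ∈ openConnIn (↑(box 3 (2 * n)) : Set (Site 3)) (x i) y) ∧
            ∀ i j, i ≠ j → ω ∉ openConnIn (↑(box 3 (2 * n)) : Set (Site 3)) (x i) (x j)}) *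
        ((∑ x ∈ box 3 (2 * n), ∑ y ∈ box 3 (2 * n),
            (bondPercolation (zdGraph 3) (criticalProbI 3)).real
              (openConnIn (↑(box 3 (2 * n)) : Set (Site 3)) x y)) /
          ((box 3 (2 * n)).card : ℝ) ^ 2)) →
      ∃ β : ℝ, 0 < β ∧ ∀ a C : ℝ, 2 - β < a →
        (∀ n : ℕ, 1 ≤ n →
          (∑ x ∈ box 3 n, ∑ y ∈ box 3 n,
              (bondPercolation (zdGraph 3) (criticalProbI 3)).real
                (openConnIn (↑(box 3 n) : Set (Site 3)) x y)) /
            ((box 3 n).card : ℝ) ^ 2 ≤ C * (n : ℝ) ^ (-a)) →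
        ∃ C' : ℝ, ∀ m : ℕ, 1 ≤ m →
          oneArmProb 3 (criticalProbI 3) m ≤ C' * (m : ℝ) ^ (-((a - 2 + β) / 2)) :=
  -- LANDED: p125680, Theorems/PercNonProliferationFreeBoxPowerSavingUnconditionalArmFromCrux.lean
  Summit.CriticalPhenomena.PercolationContinuityZ3.FreeBoxPowerSavingLine.stub_unconditionalArmFromCrux

/-- **stub_cesaroBlockingGivesOneArm (Cesàro blocking ⟹ one-arm power decay; every `p`; provable now, M).**
BK/Reimer over the nested dyadic annuli: on `ω ⊆ E(ℤ³)`, an open path from `0` to `∂ⁱⁿB(2^K)` inside `B(2^K)`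
(w.l.o.g. self-avoiding) contains, for each `j < K`, a sub-path from `∂ⁱⁿB(2^j) ⊆ B(2^j)` to `∂ⁱⁿB(2^{j+1})` inside
`B(2^{j+1})` (between its last visit to `B(2^j)` before the first hit of `∂ⁱⁿB(2^{j+1})` and that hit), and these
`K` sub-paths are pairwise EDGE-disjoint; so `{0 ↔ ∂ⁱⁿB(2^K)} ⊆ A_0 □ (A_1 □ ⋯)` with
`A_j = {B(2^j) ↔ ∂ⁱⁿB(2^{j+1}) in B(2^{j+1})}` (increasing, finitary: `isFinitary_openConnIn` + finite unions;
`mem_disjointOccurrenceList_of_pairwise_disjoint`), and `bk_finitary_list` gives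
`π_p(2^K) ≤ Π_{j<K} (1 - u_{2^j}) ≤ exp(-Σ_{j<K} u_{2^j}) ≤ e^{-cK}` eventually in `K`; for `2^K ≤ m < 2^{K+1}`,
`π(m) ≤ π(2^K)` (`DCT16.real_siteToBoundary_antitone`) `≤ e^{c} m^{-c/log 2}`; small `m` go into the constant. [folklore] -/
theorem stub_cesaroBlockingGivesOneArm :
    ∀ p : unitInterval,
      (∃ c : ℝ, 0 < c ∧ ∀ᶠ K : ℕ in atTop, c * (K : ℝ) ≤
        ∑ j ∈ Finset.range K, (bondPercolation (zdGraph 3) p).real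
          {ω | ¬ ∃ x ∈ box 3 (2 ^ j), ∃ y ∈ innerBoundary (zdGraph 3) (box 3 (2 * 2 ^ j)),
            ω ∈ openConnIn (↑(box 3 (2 * 2 ^ j)) : Set (Site 3)) x y}) →
      ∃ s C : ℝ, 0 < s ∧ ∀ m : ℕ, 1 ≤ m → oneArmProb 3 p m ≤ C * (m : ℝ) ^ (-s) :=
  -- LANDED: p126229, Theorems/PercNonProliferationFreeBoxPowerSavingCesaroBlockingGivesOneArm.lean
  Summit.CriticalPhenomena.PercolationContinuityZ3.FreeBoxPowerSavingLine.stub_cesaroBlockingGivesOneArm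

/-- **stub_cesaroBlocking (the TRANSFER stub; OPEN, lead-held; SUMMIT-strength).**  At `p_c(ℤ³)` the dyadic
annuli `B(2^{j+1}) ∖ B(2^j)` are blocked at a positive rate along the scale axis:
`∃ c > 0, ∀ᶠ K, c·K ≤ Σ_{j<K} u_{2^j}(p_c)`.  Weaker than `X_B = CritAnnulusNonCrossing` (all scales, route
PercAnnulusCrossing), incomparable with r4 (all scales, vanishing bound), false above six dimensions
(`Literature.Barriers.CriticalPhenomena.SpanningClustersAboveSix`: crossings certain), and by this file it implies
`θ(p_c) = 0`; no engine in print (RSW-type lower bounds for decreasing events on `ℤ³` are open). [folklore] -/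
theorem stub_cesaroBlocking :
    ∃ c : ℝ, 0 < c ∧ ∀ᶠ K : ℕ in atTop, c * (K : ℝ) ≤
      ∑ j ∈ Finset.range K, (bondPercolation (zdGraph 3) (criticalProbI 3)).real
        {ω | ¬ ∃ x ∈ box 3 (2 ^ j), ∃ y ∈ innerBoundary (zdGraph 3) (box 3 (2 * 2 ^ j)),
          ω ∈ openConnIn (↑(box 3 (2 * 2 ^ j)) : Set (Site 3)) x y} := by
  sorry

/-! ### Consistency: each name-keyed statement IS its stub (definitionally) -/

theorem stub_armCauchySchwarz_registered : Sig.stub_armCauchySchwarz := stub_armCauchySchwarz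
theorem stub_pairGivesOneArm_registered : Sig.stub_pairGivesOneArm := stub_pairGivesOneArm
theorem stub_unconditionalArmFromCrux_registered : Sig.stub_unconditionalArmFromCrux :=
  stub_unconditionalArmFromCrux
theorem stub_cesaroBlockingGivesOneArm_registered : Sig.stub_cesaroBlockingGivesOneArm :=
  stub_cesaroBlockingGivesOneArm
theorem stub_cesaroBlocking_registered : Sig.stub_cesaroBlocking := stub_cesaroBlocking

/-! ## §4 Glue proved here: the arm floor and the ASP inequality -/

/-- **Arm floor** `|B(n)| · π_p(3n) ≤ A_p(n)`: for `x ∈ B(n)`, `B(2n) ⊆ x + B(3n)`, so an open path from `x`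
to `x + ∂ⁱⁿB(3n)` reaches `∂ⁱⁿB(2n)` by an initial segment inside `B(2n)` (tree:
`oneArmProb_three_mul_le_real_toBdry`, first exit + translation invariance); sum over `x`. [folklore] -/
theorem armFloor (p : unitInterval) (n : ℕ) :
    ((box 3 n).card : ℝ) * oneArmProb 3 p (3 * n) ≤ armMass p n := by
  unfold armMass
  rw [← nsmul_eq_mul, ← Finset.sum_const]
  exact Finset.sum_le_sum fun x hx =>
    Summit.CriticalPhenomena.PercolationContinuityZ3.Theorems.oneArmProb_three_mul_le_real_toBdry p hx

/-- `E_p[S_n] ≤ S_p(2n)`: pairs of `B(n)` joined inside `B(2n)` are among the pairs of `B(2n)` joined inside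
`B(2n)`. [folklore] -/
theorem pairsIn_le_pairSum (p : unitInterval) (n : ℕ) : pairsIn p n ≤ pairSum p (2 * n) := by
  unfold pairsIn pairSum
  exact Summit.CriticalPhenomena.PercolationContinuityZ3.Theorems.polynomialAssembly_sum_sum_mono
    (box_mono 3 (by omega)) fun x y => measureReal_nonneg

/-- `E_p[N_n] ≥ 0`. [folklore] -/
theorem meanSpanning_nonneg (p : unitInterval) (n : ℕ) : 0 ≤ meanSpanning p n :=
  Finset.sum_nonneg fun _ _ => measureReal_nonneg

/-- **The arm–spanning–pair inequality (ASP)** from the arm-mass Cauchy–Schwarz: for every `p` and `n ≥ 1`,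
`π_p(3n)² ≤ 64 · E_p[N_n] · FA₂ᵖ(2n)`.  Chain: `(|B(n)| π(3n))² ≤ A² ≤ E[N]·E[S] ≤ E[N]·S(2n) =
E[N]·FA₂(2n)·|B(2n)|² ≤ E[N]·FA₂(2n)·64|B(n)|²`. [folklore] -/
theorem armSpanningPair_of (hA : Sig.stub_armCauchySchwarz) (p : unitInterval) (n : ℕ) (_hn : 1 ≤ n) :
    oneArmProb 3 p (3 * n) ^ 2 ≤ 64 * meanSpanning p n * fa2 p (2 * n) := by
  have hCS := (sig_armCauchySchwarz_iff.1 hA) p n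
  have hb := card_box_pos n
  have hb2 := card_box_pos (2 * n)
  have h8 := Summit.CriticalPhenomena.PercolationContinuityZ3.Theorems.FreeBoxSparse.Negative.card_box_two_mul_le n
  have hπ0 : 0 ≤ oneArmProb 3 p (3 * n) := measureReal_nonneg
  have hEN := meanSpanning_nonneg p n
  have hF0 := fa2_nonneg p (2 * n)
  have hfloor := armFloor p n
  -- `E[S] ≤ FA₂(2n) · |B(2n)|²`
  have hS : pairsIn p n ≤ fa2 p (2 * n) * ((box 3 (2 * n)).card : ℝ) ^ 2 := by
    have : fa2 p (2 * n) * ((box 3 (2 * n)).card : ℝ) ^ 2 = pairSum p (2 * n) := by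
      unfold fa2; field_simp
    rw [this]; exact pairsIn_le_pairSum p n
  have hsq : (((box 3 n).card : ℝ) * oneArmProb 3 p (3 * n)) ^ 2 ≤ armMass p n ^ 2 :=
    pow_le_pow_left₀ (by positivity) hfloor 2
  have hb2sq : ((box 3 (2 * n)).card : ℝ) ^ 2 ≤ 64 * ((box 3 n).card : ℝ) ^ 2 := by
    calc ((box 3 (2 * n)).card : ℝ) ^ 2 ≤ (8 * ((box 3 n).card : ℝ)) ^ 2 := pow_le_pow_left₀ hb2.le h8 2
      _ = 64 * ((box 3 n).card : ℝ) ^ 2 := by ring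
  have key : ((box 3 n).card : ℝ) ^ 2 * oneArmProb 3 p (3 * n) ^ 2 ≤
      ((box 3 n).card : ℝ) ^ 2 * (64 * meanSpanning p n * fa2 p (2 * n)) := by
    calc ((box 3 n).card : ℝ) ^ 2 * oneArmProb 3 p (3 * n) ^ 2
        = (((box 3 n).card : ℝ) * oneArmProb 3 p (3 * n)) ^ 2 := by ring
      _ ≤ armMass p n ^ 2 := hsq
      _ ≤ meanSpanning p n * pairsIn p n := hCS
      _ ≤ meanSpanning p n * (fa2 p (2 * n) * ((box 3 (2 * n)).card : ℝ) ^ 2) :=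
          mul_le_mul_of_nonneg_left hS hEN
      _ ≤ meanSpanning p n * (fa2 p (2 * n) * (64 * ((box 3 n).card : ℝ) ^ 2)) :=
          mul_le_mul_of_nonneg_left (mul_le_mul_of_nonneg_left hb2sq hF0) hEN
      _ = ((box 3 n).card : ℝ) ^ 2 * (64 * meanSpanning p n * fa2 p (2 * n)) := by ring
  exact le_of_mul_le_mul_left key (by positivity)

/-- ASP in the registered (def-free) shape used as the hypothesis of `stub_pairGivesOneArm`. [folklore] -/
theorem armSpanningPair_sig_of (hA : Sig.stub_armCauchySchwarz) :
    ∀ (p : unitInterval) (n : ℕ), 1 ≤ n →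
      oneArmProb 3 p (3 * n) ^ 2 ≤
        64 * (∑ k ∈ Finset.range (box 3 n).card, (bondPercolation (zdGraph 3) p).real
          {ω | ∃ x : Fin (k + 1) → Site 3, (∀ i, x i ∈ box 3 n) ∧
            (∀ i, ∃ y ∈ innerBoundary (zdGraph 3) (box 3 (2 * n)),
              ω ∈ openConnIn (↑(box 3 (2 * n)) : Set (Site 3)) (x i) y) ∧
            ∀ i j, i ≠ j → ω ∉ openConnIn (↑(box 3 (2 * n)) : Set (Site 3)) (x i) (x j)}) *
        ((∑ x ∈ box 3 (2 * n), ∑ y ∈ box 3 (2 * n),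
            (bondPercolation (zdGraph 3) p).real (openConnIn (↑(box 3 (2 * n)) : Set (Site 3)) x y)) /
          ((box 3 (2 * n)).card : ℝ) ^ 2) :=
  fun p n hn => armSpanningPair_of hA p n hn

/-- **stub_armSpanningPair (ASP; every `p`, `n ≥ 1`; PROVED here from the landed arm-mass Cauchy–Schwarz and the
glue `armSpanningPair_of`; registered (v3) so that the dictionary file `Theorems/…OneArmDictionary.lean` lands it by
name).**  `π_p(3n)² ≤ 64 · E_p[N_n] · FA₂ᵖ(2n)`. [folklore] -/
theorem stub_armSpanningPair :
    ∀ (p : unitInterval) (n : ℕ), 1 ≤ n →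
      oneArmProb 3 p (3 * n) ^ 2 ≤
        64 * (∑ k ∈ Finset.range (box 3 n).card, (bondPercolation (zdGraph 3) p).real
          {ω | ∃ x : Fin (k + 1) → Site 3, (∀ i, x i ∈ box 3 n) ∧
            (∀ i, ∃ y ∈ innerBoundary (zdGraph 3) (box 3 (2 * n)),
              ω ∈ openConnIn (↑(box 3 (2 * n)) : Set (Site 3)) (x i) y) ∧
            ∀ i j, i ≠ j → ω ∉ openConnIn (↑(box 3 (2 * n)) : Set (Site 3)) (x i) (x j)}) *
        ((∑ x ∈ box 3 (2 * n), ∑ y ∈ box 3 (2 * n),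
            (bondPercolation (zdGraph 3) p).real (openConnIn (↑(box 3 (2 * n)) : Set (Site 3)) x y)) /
          ((box 3 (2 * n)).card : ℝ) ^ 2) :=
  armSpanningPair_sig_of stub_armCauchySchwarz_registered

theorem stub_armSpanningPair_registered : Sig.stub_armSpanningPair := stub_armSpanningPair

/-! ## §5 Composition (kernel-checked, no `sorry` outside the stubs) -/

/-- **`FreeBoxPowerSaving_of`**: the transfer stub gives the crux BY NAME — Cesàro blocking at `p_c` ⟹ one-arm
power decay at `p_c` (`stub_cesaroBlockingGivesOneArm`) ⟹ the crux (landed `of_oneArm_decay`, p75695, `a = 2 min(s,1)`).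
[folklore] -/
theorem FreeBoxPowerSaving_of (hCB : Sig.stub_cesaroBlocking) :
    Summit.CriticalPhenomena.PercolationContinuityZ3.Theses.PercNonProliferation.FreeBoxPowerSaving := by
  obtain ⟨s, C, hs, hC⟩ := stub_cesaroBlockingGivesOneArm (criticalProbI 3) hCB
  exact of_oneArm_decay hs hC

/-- **The dictionary, converse half**: given r4, the crux gives one-arm power decay at `p_c`
(arm-mass Cauchy–Schwarz + ASP glue + `stub_pairGivesOneArm`). [folklore] -/
theorem oneArmPowerDecay_of_crux (hA : Sig.stub_armCauchySchwarz) (hP : Sig.stub_pairGivesOneArm)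
    (h4 : SubpolynomialBlocking) (h5 : FreeBoxPowerSaving) : OneArmPowerDecayAt (criticalProbI 3) :=
  (sig_pairGivesOneArm_iff.1 hP) (armSpanningPair_of hA) h4 h5

/-- **Given r4 `SubpolynomialBlocking`, the crux IS polynomial one-arm decay at `p_c(ℤ³)`** (dictionary `a = 2s`
both ways: `stub_pairGivesOneArm`, and the landed `of_oneArm_decay` (p75695) for the converse — the latter is
inlined here rather than re-exported as a named `OneArmPowerDecayAt p_c → crux` theorem, so that
`FreeBoxPowerSaving_of` stays the file's only theorem concluding the crux by name). [folklore] -/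
theorem crux_iff_oneArmPowerDecay_of_subpolynomialBlocking (hA : Sig.stub_armCauchySchwarz)
    (hP : Sig.stub_pairGivesOneArm) (h4 : SubpolynomialBlocking) :
    FreeBoxPowerSaving ↔ OneArmPowerDecayAt (criticalProbI 3) :=
  ⟨oneArmPowerDecay_of_crux hA hP h4, fun ⟨_, _, hs, hC⟩ => of_oneArm_decay hs hC⟩

/-- **The polynomial pair re-priced**: r4 ∧ r5 ⟹ one-arm power decay ⟹ `θ(p_c) = 0` with a RATE
(`θ(p_c) ≤ π_{p_c}(m) ≤ C m^{-s}`; `theta_le_real_siteToBoundary`), so `PolynomialAssembly` factors through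
`OneArmPowerDecayAt (criticalProbI 3)`. [folklore] -/
theorem theta_eq_zero_of_oneArmPowerDecay (h : OneArmPowerDecayAt (criticalProbI 3)) :
    theta (zdGraph 3) (0 : Site 3) (criticalProbI 3) = 0 := by
  obtain ⟨s, C, hs, hC⟩ := h
  have hθ0 : 0 ≤ theta (zdGraph 3) (0 : Site 3) (criticalProbI 3) := measureReal_nonneg
  have hle : ∀ m : ℕ, 1 ≤ m → theta (zdGraph 3) (0 : Site 3) (criticalProbI 3) ≤ C * (m : ℝ) ^ (-s) :=
    fun m hm => (DCT16.theta_le_real_siteToBoundary (criticalProbI 3) m).trans (hC m hm)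
  have hlim : Tendsto (fun m : ℕ => C * (m : ℝ) ^ (-s)) atTop (𝓝 0) := by
    have h := ((tendsto_rpow_neg_atTop hs).comp tendsto_natCast_atTop_atTop).const_mul C
    rw [mul_zero] at h
    exact h
  have hev : ∀ᶠ m : ℕ in atTop, theta (zdGraph 3) (0 : Site 3) (criticalProbI 3) ≤ C * (m : ℝ) ^ (-s) :=
    (eventually_ge_atTop 1).mono hle
  exact le_antisymm (ge_of_tendsto hlim hev) hθ0

/-! ## §6 Wiring check -/

example : Summit.CriticalPhenomena.PercolationContinuityZ3.Theses.PercNonProliferation.FreeBoxPowerSaving :=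
  FreeBoxPowerSaving_of stub_cesaroBlocking

/-- Landed negative lemma the stub set is checked against: at `p = 1` the crux is FALSE; there `u_m(1) = 0`
(crossings sure), so `stub_cesaroBlocking`'s analogue fails — `p = p_c` enters only through the transfer stub.
[folklore] -/
example := @Summit.CriticalPhenomena.PercolationContinuityZ3.FreeBoxPowerSavingNegative.false_at_one

end Summit.CriticalPhenomena.PercolationContinuityZ3.Cruxes.FreeBoxPowerSaving.OneArmCurrencyLine
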